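import Literature.Probability.RandomPlanarGeometry.PolylineShellTraversals
import HarnessLib

/-!
# Weak vertex traversals of a list give separate traversals of its polyline in a shrunk shell

The converse entry of the dictionary of `PolylineShellTraversals.lean` between Aizenman–Burchard's
event "the shell `D(x; r, R)` is traversed by `k` separate segments" (`Curve.HasTraversals`, AB99
§1.b (1.3)) for a POLYLINE `polyline l` and the WEAK vertex traversals of its list of points `l`
(indices `ι m ≤ κ m` on opposite sides of the shell, `κ m ≤ ι m'` for `m < m'`: consecutive
traversals may SHARE a vertex):

* `exists_lt_le_lt_of_continuous` — two applications of the intermediate value theorem on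
  `[0, 1]`: a continuous function that is `≤ p₀` at `a` and `≥ q₀` at `b` takes two intermediate
  values `p < q` at times `a < s ≤ t < b`;
* `Curve.IsTraversal.exists_strict` — a traversal of `D(x; r, R)` on `[a, b]` contains a traversal
  of every STRICTLY shrunk shell `D(x; r', R')`, `r < r' < R' < R`, on some `[s, t]` with
  `a < s`, `t < b`;
* `Curve.hasTraversals_of_weakSep` — `k` traversals on WEAKLY disjoint parameter intervals
  (`t i ≤ s j` for `i < j`) give `k` separate traversals of every strictly shrunk shell;
* `hasTraversals_polyline_of_vertexTraversals` — `k` weak vertex traversals of `D(x; r, R)` by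
  the list `l` give `k` separate traversals of `D(x; r', R')` by `polyline l`.

Sources: M. Aizenman, A. Burchard, Duke Math. J. 99 (1999) §1.b and §3.a (discretisation of
traversal counts in the proof of Lemma 3.1); folklore. Deliberately NOT here: lattices, measures;
no new definitions. Mathlib anchor: `intermediate_value_Icc` on `unitInterval`.
-/

open Set Metric
open scoped unitInterval

noncomputable section

namespace Literature.Probability.RandomPlanarGeometry

/-! ### Strict re-timing of a traversal inside a shrunk shell -/

section Retiming

variable {E : Type*} [PseudoMetricSpace E]

/-- Two intermediate values at strictly interior, ordered times: if `f` is continuous on `[0, 1]`,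
`f a ≤ p₀` and `q₀ ≤ f b` with `a ≤ b` and `p₀ < p < q < q₀`, then `f s = p`, `f t = q` for some
`a < s ≤ t < b`. [folklore] -/
theorem exists_lt_le_lt_of_continuous {f : I → ℝ} (hf : Continuous f) {a b : I} (hab : a ≤ b)
    {p₀ p q q₀ : ℝ} (hp : p₀ < p) (hpq : p < q) (hq : q < q₀) (ha : f a ≤ p₀) (hb : q₀ ≤ f b) :
    ∃ s t : I, a < s ∧ s ≤ t ∧ t < b ∧ f s = p ∧ f t = q := by
  obtain ⟨t, ⟨hat, htb⟩, hft⟩ := intermediate_value_Icc hab hf.continuousOn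
    (show q ∈ Icc (f a) (f b) from ⟨by linarith, by linarith⟩)
  obtain ⟨s, ⟨has, hst⟩, hfs⟩ := intermediate_value_Icc hat hf.continuousOn
    (show p ∈ Icc (f a) (f t) from ⟨by linarith, by linarith⟩)
  refine ⟨s, t, has.lt_of_ne ?_, hst, htb.lt_of_ne ?_, hfs, hft⟩
  · rintro rfl
    linarith
  · rintro rfl
    linarith

/-- **A traversal contains a strictly interior traversal of every strictly shrunk shell.** If the
segment of `γ` on `[a, b]` traverses `D(x; r, R)` and `r < r' < R' < R`, then a segment on some
`[s, t]` with `a < s`, `t < b` traverses `D(x; r', R')` (intermediate value theorem, twice).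
[cite: AizenmanBurchard1999, §3.a (proof of Lemma 3.1)] -/
theorem Curve.IsTraversal.exists_strict {γ : Curve E} {x : E} {r r' R' R : ℝ} {a b : I}
    (h : γ.IsTraversal x r R a b) (hrr' : r < r') (hr'R' : r' < R') (hR'R : R' < R) :
    ∃ s t : I, a < s ∧ t < b ∧ γ.IsTraversal x r' R' s t := by
  have hf : Continuous fun u => dist (γ u) x := γ.continuous.dist continuous_const
  rcases h.2 with ⟨ha, hb⟩ | ⟨ha, hb⟩
  · -- near → far: pass radius `R'` at `t`, radius `r'` at `s ≤ t`
    obtain ⟨s, t, has, hst, htb, hfs, hft⟩ :=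
      exists_lt_le_lt_of_continuous hf h.1 hrr' hr'R' hR'R ha hb
    exact ⟨s, t, has, htb, hst, Or.inl ⟨hfs.le, hft.ge⟩⟩
  · -- far → near: the same for `-dist`
    obtain ⟨s, t, has, hst, htb, hfs, hft⟩ :=
      exists_lt_le_lt_of_continuous (f := fun u => -dist (γ u) x) hf.neg h.1 (neg_lt_neg hR'R)
        (neg_lt_neg hr'R') (neg_lt_neg hrr') (neg_le_neg ha) (neg_le_neg hb)
    exact ⟨s, t, has, htb, hst, Or.inr ⟨by linarith, by linarith⟩⟩

/-- **Weakly separated traversals are separate in every strictly shrunk shell.** If `γ` traverses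
`D(x; r, R)` on `k` parameter intervals `[s i, t i]` that are disjoint up to endpoints and listed
in increasing order (`t i ≤ s j` for `i < j`), then `γ` makes `k` separate traversals of every
strictly shrunk shell `D(x; r', R')`, `r < r' < R' < R`.
[cite: AizenmanBurchard1999, §3.a (proof of Lemma 3.1)] -/
theorem Curve.hasTraversals_of_weakSep {γ : Curve E} {k : ℕ} {x : E} {r r' R' R : ℝ}
    (hrr' : r < r') (hr'R' : r' < R') (hR'R : R' < R)
    (h : ∃ s t : Fin k → I, (∀ i, γ.IsTraversal x r R (s i) (t i)) ∧
      ∀ ⦃i j : Fin k⦄, i < j → t i ≤ s j) :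
    γ.HasTraversals k x r' R' := by
  obtain ⟨s, t, hst, hsep⟩ := h
  choose s' t' hs' ht' hst' using fun i => (hst i).exists_strict hrr' hr'R' hR'R
  exact ⟨s', t', hst', fun i j hij => ((ht' i).trans_le (hsep hij)).trans (hs' j)⟩

end Retiming

/-! ### Weak vertex traversals of a list and its polyline -/

section Polyline

open Literature.Probability.LatticeModels

variable {E : Type*} [NormedAddCommGroup E] [NormedSpace ℝ E]

/-- **Weak vertex traversals give separate traversals of the polyline in a shrunk shell.** If the
list `l` has `k` weak vertex traversals of `D(x; r, R)` (indices `ι m ≤ κ m` whose points lie on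
opposite sides of the shell, `κ m ≤ ι m'` for `m < m'`), then the polyline through `l` traverses
every strictly shrunk shell `D(x; r', R')`, `r < r' < R' < R`, by `k` separate segments: the
vertices are visited in order, and each traversal is re-timed strictly inside its vertex interval
by the intermediate value theorem. The converse of `vertexTraversals_of_hasTraversals_polyline`.
[cite: AizenmanBurchard1999, §3.a (proof of Lemma 3.1)] -/
theorem hasTraversals_polyline_of_vertexTraversals {l : List E} {k : ℕ} {x : E}
    {r r' R' R : ℝ} (hrr' : r < r') (hr'R' : r' < R') (hR'R : R' < R)
    (h : ∃ ι κ : Fin k → Fin l.length, (∀ m, ι m ≤ κ m) ∧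
      (∀ m, (dist (l.get (ι m)) x ≤ r ∧ R ≤ dist (l.get (κ m)) x) ∨
        (R ≤ dist (l.get (ι m)) x ∧ dist (l.get (κ m)) x ≤ r)) ∧ ∀ ⦃m m'⦄, m < m' → κ m ≤ ι m') :
    (⟨polyline l⟩ : Curve E).HasTraversals k x r' R' := by
  obtain ⟨ι, κ, h1, h2, h3⟩ := h
  cases l with
  | nil =>
    -- no indices into the empty list: `k = 0`
    rcases Nat.eq_zero_or_pos k with rfl | hk
    · exact Curve.hasTraversals_zero _ _ _ _
    · exact (Nat.not_lt_zero _ (ι ⟨0, hk⟩).isLt).elim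
  | cons a l =>
    obtain ⟨T, hTmono, hTval⟩ := exists_vertexTimes_polylineFrom a l
    have hTle : ∀ i j : Fin (a :: l).length, i ≤ j → T i ≤ T j := by
      intro i j hij
      rcases hij.lt_or_eq with hlt | heq
      · exact (hTmono i j hlt (by have := j.isLt; simp at this; omega)).le
      · rw [show i = j from hij.antisymm (heq ▸ le_rfl)]
    have hval : ∀ i : Fin (a :: l).length,
        (⟨polyline (a :: l)⟩ : Curve E) (T i) = (a :: l).get i := fun i => by
      change (polylineFrom a l).2 (T i) = _
      rw [hTval i i.isLt, List.get_eq_getElem]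
    refine Curve.hasTraversals_of_weakSep hrr' hr'R' hR'R
      ⟨fun m => T (ι m), fun m => T (κ m), fun m => ⟨hTle _ _ (h1 m), ?_⟩,
        fun m m' hmm' => hTle _ _ (h3 hmm')⟩
    rw [hval, hval]
    exact h2 m

end Polyline

end Literature.Probability.RandomPlanarGeometry

end
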